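import Summits.CriticalPhenomena.SAWScalingLimit.Theorems.SAWTensorRGRestrictionOfLimitRadoData
import Summits.CriticalPhenomena.SAWScalingLimit.Theorems.SAWTensorRGRestrictionOfLimitRadoAux
import HarnessLib

/-!
# Radó squeezes, part 9: only finitely many defect sides are large

Support file (`--supports stmt-CriticalPhenomena-0773`, towards the registered stub `stub_radoSqueezeFamily`,
geometry F′ of the line `birth` for the crux `RestrictionOfLimit`). Pure plane topology / real analysis.

Enumerate the free arcs of a Jordan sub-domain `D' ⊆ D` by the FIRST HITS of a sequence `xs` of reals
(`rep n`: `xs n` is a free parameter of the window whose component differs from those of the earlier good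
members). For the defect data `d n` of the representatives (part 8) we prove that for every `ε > 0` only finitely
many representatives have `diam (frontier (d n).U) ≥ ε` (`finite_large_frontier`): `frontier U = ᾱ ∪ β` with
`ᾱ = D'.boundary '' [θ₁, θ₂]`, `β = D.boundary '' [s, t]`; the parameter intervals `(θ₁, θ₂) ⊆ (m₀, m₀ + 1)` of
distinct representatives are disjoint (distinct components), and so are the normalised intervals
`(s, t) ⊆ [D.mark 0, D.mark 0 + 1]` (a common parameter would give a common point of two open arcs `β°`, which
lie in disjoint closures off `{P, Q}`); by uniform continuity of the two boundary loops a large arc needs a long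
parameter interval, and disjoint long sub-intervals of a unit interval are finitely many (part 7). Consequently,
off a finite set of representatives, every point of `closure (d n).U` is `ε`-close to every point of the closed
free arc (`dist_lt_of_not_mem_large`, using part 7's `dist_le_diam_frontier`).

Axioms `propext`, `Classical.choice`, `Quot.sound`.
-/

noncomputable section

open Set Filter Topology Metric Complex
open Literature.Topology.PlaneTopology Literature.Probability.RandomPlanarGeometry

namespace Summit.CriticalPhenomena.SAWScalingLimit.Theorems.RestrictionOfLimit.Birth

/-! ### Large arcs need long parameter intervals -/

/-- **Only finitely many disjoint parameter sub-intervals of a window carry arcs of diameter `≥ ε`.** [folklore] -/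
theorem finite_large_image {c : ℝ → ℂ} (hc : Continuous c) {S : Set ℕ} {u v : ℕ → ℝ} {μ : ℝ}
    (hst : ∀ n ∈ S, μ ≤ u n ∧ u n < v n ∧ v n ≤ μ + 1) (hdisj : S.PairwiseDisjoint fun n ↦ Ioo (u n) (v n))
    {ε : ℝ} (hε : 0 < ε) : {n ∈ S | ε ≤ diam (c '' Icc (u n) (v n))}.Finite := by
  have huc : UniformContinuousOn c (Icc μ (μ + 1)) := isCompact_Icc.uniformContinuousOn_of_continuous
      hc.continuousOn
  obtain ⟨δ, hδ, hδε⟩ := Metric.uniformContinuousOn_iff.1 huc (ε / 2) (half_pos hε)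
  have hsmall : ∀ n ∈ S, v n - u n < δ → diam (c '' Icc (u n) (v n)) ≤ ε / 2 := by
    intro n hn hlen
    refine diam_le_of_forall_dist_le (half_pos hε).le ?_
    rintro _ ⟨a, ha, rfl⟩ _ ⟨b, hb, rfl⟩
    obtain ⟨h1, -, h3⟩ := hst n hn
    refine (hδε a ⟨h1.trans ha.1, ha.2.trans h3⟩ b ⟨h1.trans hb.1, hb.2.trans h3⟩ ?_).le
    rw [Real.dist_eq, abs_lt]
    constructor <;> linarith [ha.1, ha.2, hb.1, hb.2]
  have hsub : {n ∈ S | ε ≤ diam (c '' Icc (u n) (v n))} ⊆ {n ∈ S | δ ≤ v n - u n} := by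
    rintro n ⟨hn, hεn⟩
    refine ⟨hn, ?_⟩
    by_contra hlt
    have := hsmall n hn (not_le.1 hlt)
    linarith
  refine Set.Finite.subset ?_ hsub
  exact finite_of_le_length_of_disjoint (S := {n ∈ S | δ ≤ v n - u n}) hδ
    (fun n hn ↦ ⟨(hst n hn.1).1, (hst n hn.1).2.2⟩) (fun n hn ↦ hn.2) (hdisj.subset fun n hn ↦ hn.1)

/-! ### The enumeration by first hits -/

section Enumeration

variable {D D' : DobrushinDomain} {F : Set ℝ} (hF : F = {θ : ℝ | D'.boundary θ ∈ D.carrier})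
  (hsub : D'.carrier ⊆ D.carrier) (h0 : D'.pt 0 = D.pt 0) (h1 : D'.pt 1 = D.pt 1) (xs : ℕ → ℝ)
  (d : ∀ n : ℕ, xs n ∈ F ∧ xs n ∈ Ioo (D'.mark 0) (D'.mark 0 + 1) → DefectData D D' F (xs n))

/-- Components of distinct representatives are disjoint open intervals. [folklore] -/
theorem rep_disjoint_components {n m : ℕ}
    (hn : (xs n ∈ F ∧ xs n ∈ Ioo (D'.mark 0) (D'.mark 0 + 1)) ∧
      ∀ k < n, xs k ∈ F ∧ xs k ∈ Ioo (D'.mark 0) (D'.mark 0 + 1) →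
        connectedComponentIn F (xs k) ≠ connectedComponentIn F (xs n))
    (hm : (xs m ∈ F ∧ xs m ∈ Ioo (D'.mark 0) (D'.mark 0 + 1)) ∧
      ∀ k < m, xs k ∈ F ∧ xs k ∈ Ioo (D'.mark 0) (D'.mark 0 + 1) →
        connectedComponentIn F (xs k) ≠ connectedComponentIn F (xs m))
    (hnm : n ≠ m) : connectedComponentIn F (xs n) ≠ connectedComponentIn F (xs m) := by
  rcases lt_or_gt_of_ne hnm with h | h
  · exact hm.2 n h hn.1
  · exact fun heq ↦ hn.2 m h hm.1 heq.symm

include hF hsub h0 h1 in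
/-- **Only finitely many representatives have a large defect frontier.** [folklore] -/
theorem finite_large_frontier {ε : ℝ} (hε : 0 < ε) :
    {n : ℕ | ∃ h : (xs n ∈ F ∧ xs n ∈ Ioo (D'.mark 0) (D'.mark 0 + 1)) ∧
        ∀ k < n, xs k ∈ F ∧ xs k ∈ Ioo (D'.mark 0) (D'.mark 0 + 1) →
          connectedComponentIn F (xs k) ≠ connectedComponentIn F (xs n),
      ε ≤ diam (frontier (d n h.1).U)}.Finite := by
  classical
  -- the set of representatives and the two parameter families
  set R : Set ℕ := {n | (xs n ∈ F ∧ xs n ∈ Ioo (D'.mark 0) (D'.mark 0 + 1)) ∧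
    ∀ k < n, xs k ∈ F ∧ xs k ∈ Ioo (D'.mark 0) (D'.mark 0 + 1) →
      connectedComponentIn F (xs k) ≠ connectedComponentIn F (xs n)} with hR
  set θ₁ : ℕ → ℝ := fun n ↦ sInf (connectedComponentIn F (xs n)) with hθ₁
  set θ₂ : ℕ → ℝ := fun n ↦ sSup (connectedComponentIn F (xs n)) with hθ₂
  set sf : ℕ → ℝ := fun n ↦ if h : xs n ∈ F ∧ xs n ∈ Ioo (D'.mark 0) (D'.mark 0 + 1) then (d n h).s else 0
    with hsf
  set tf : ℕ → ℝ := fun n ↦ if h : xs n ∈ F ∧ xs n ∈ Ioo (D'.mark 0) (D'.mark 0 + 1) then (d n h).t else 0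
    with htf
  have hsf_eq : ∀ n (h : xs n ∈ F ∧ xs n ∈ Ioo (D'.mark 0) (D'.mark 0 + 1)), sf n = (d n h).s := fun n h ↦ by
    simp only [hsf, dif_pos h]
  have htf_eq : ∀ n (h : xs n ∈ F ∧ xs n ∈ Ioo (D'.mark 0) (D'.mark 0 + 1)), tf n = (d n h).t := fun n h ↦ by
    simp only [htf, dif_pos h]
  -- the free-arc family
  have hA : {n ∈ R | ε / 2 ≤ diam (D'.boundary '' Icc (θ₁ n) (θ₂ n))}.Finite := by
    refine finite_large_image D'.continuous_boundary (μ := D'.mark 0) (fun n hn ↦ ?_) ?_ (half_pos hε)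
    · obtain ⟨-, -, -, hl, hr, hix, hxs, -⟩ := free_component hF h0 h1 hn.1.1 hn.1.2
      exact ⟨hl, hix.trans hxs, hr⟩
    · intro n hn m hm hnm
      obtain ⟨heqn, -⟩ := free_component hF h0 h1 hn.1.1 hn.1.2
      obtain ⟨heqm, -⟩ := free_component hF h0 h1 hm.1.1 hm.1.2
      refine Set.disjoint_left.2 fun z hzn hzm ↦ rep_disjoint_components xs hn hm hnm ?_
      have hzn' : z ∈ connectedComponentIn F (xs n) := by rw [heqn]; exact hzn
      have hzm' : z ∈ connectedComponentIn F (xs m) := by rw [heqm]; exact hzm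
      rw [connectedComponentIn_eq hzn', connectedComponentIn_eq hzm']
  -- the `∂D`-arc family
  have hB : {n ∈ R | ε / 2 ≤ diam (D.boundary '' Icc (sf n) (tf n))}.Finite := by
    refine finite_large_image D.continuous_boundary (μ := D.mark 0) (fun n hn ↦ ?_) ?_ (half_pos hε)
    · rw [hsf_eq n hn.1, htf_eq n hn.1]
      exact ⟨(d n hn.1).hμs, (d n hn.1).hst, (d n hn.1).htμ⟩
    · intro n hn m hm hnm
      rw [Function.onFun, hsf_eq n hn.1, htf_eq n hn.1, hsf_eq m hm.1, htf_eq m hm.1]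
      refine Set.disjoint_left.2 fun v hvn hvm ↦ ?_
      obtain ⟨hP, hQ, -⟩ := (d n hn.1).beta_open_facts hF hsub h0 h1 hn.1.1 hn.1.2 hvn
      have hfrn : D.boundary v ∈ closure (d n hn.1).U := by
        refine frontier_subset_closure ?_
        rw [(d n hn.1).hfrU]; exact Or.inr ⟨v, ⟨hvn.1.le, hvn.2.le⟩, rfl⟩
      have hfrm : D.boundary v ∈ closure (d m hm.1).U := by
        refine frontier_subset_closure ?_
        rw [(d m hm.1).hfrU]; exact Or.inr ⟨v, ⟨hvm.1.le, hvm.2.le⟩, rfl⟩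
      have hmem := (d n hn.1).closure_inter hF hsub h0 h1 hn.1.1 hn.1.2 hm.1.1 hm.1.2
        (rep_disjoint_components xs hn hm hnm) (d m hm.1) ⟨hfrn, hfrm⟩
      rcases hmem with h | h
      · exact hP h
      · exact hQ h
  -- conclusion
  refine (hA.union hB).subset ?_
  rintro n ⟨hn, hεn⟩
  have hnR : n ∈ R := hn
  set e := d n hn.1 with he
  have hPα : D'.boundary (θ₁ n) ∈ D'.boundary '' Icc (θ₁ n) (θ₂ n) := by
    obtain ⟨-, -, -, -, -, hix, hxs, -⟩ := free_component hF h0 h1 hn.1.1 hn.1.2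
    exact ⟨θ₁ n, ⟨le_rfl, (hix.trans hxs).le⟩, rfl⟩
  have hPβ : D'.boundary (θ₁ n) ∈ D.boundary '' Icc e.s e.t := by
    rcases e.hends with ⟨hs, -⟩ | ⟨-, ht⟩
    · exact ⟨e.s, ⟨le_rfl, e.hst.le⟩, hs⟩
    · exact ⟨e.t, ⟨e.hst.le, le_rfl⟩, ht⟩
  have hdiam : diam (frontier e.U) ≤ diam (D'.boundary '' Icc (θ₁ n) (θ₂ n)) + diam (D.boundary '' Icc e.s e.t)
      := by
    rw [e.hfrU]
    exact diam_union' ⟨_, hPα, hPβ⟩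
  by_contra hnot
  simp only [mem_union, mem_setOf_eq, not_or, not_and, not_le] at hnot
  have h1' := hnot.1 hnR
  have h2' := hnot.2 hnR
  rw [hsf_eq n hn.1, htf_eq n hn.1] at h2'
  linarith

include hF hsub h0 h1 in
/-- **Off a finite set of representatives, the closure of the defect side is `ε`-close to the closed free arc.**
[folklore] -/
theorem exists_finite_dist_lt {ε : ℝ} (hε : 0 < ε) :
    ∃ B : Set ℕ, B.Finite ∧ ∀ n (h : (xs n ∈ F ∧ xs n ∈ Ioo (D'.mark 0) (D'.mark 0 + 1)) ∧
        ∀ k < n, xs k ∈ F ∧ xs k ∈ Ioo (D'.mark 0) (D'.mark 0 + 1) →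
          connectedComponentIn F (xs k) ≠ connectedComponentIn F (xs n)), n ∉ B →
      ∀ z ∈ closure (d n h.1).U,
        ∀ θ ∈ Icc (sInf (connectedComponentIn F (xs n))) (sSup (connectedComponentIn F (xs n))),
          dist z (D'.boundary θ) < ε := by
  refine ⟨_, finite_large_frontier hF hsub h0 h1 xs d hε, fun n h hnB z hz θ hθ ↦ ?_⟩
  have hlt : diam (frontier (d n h.1).U) < ε := by
    by_contra hge
    exact hnB ⟨h, not_lt.1 hge⟩
  exact lt_of_le_of_lt (dist_le_diam_frontier (d n h.1).hUo (d n h.1).isBounded_U hz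
    ((d n h.1).boundary_mem_closure hθ).1) hlt

end Enumeration

/-- **Registered helper stub `stub_radoFinite`** (towards `stub_radoSqueezeFamily`, line `birth`): only finitely
many disjoint parameter sub-intervals of a window carry arcs of diameter `≥ ε`, in closed form. [folklore] -/
theorem stub_radoFinite :
    ∀ (c : ℝ → ℂ), Continuous c → ∀ (S : Set ℕ) (u v : ℕ → ℝ) (μ : ℝ),
      (∀ n ∈ S, μ ≤ u n ∧ u n < v n ∧ v n ≤ μ + 1) → S.PairwiseDisjoint (fun n => Set.Ioo (u n) (v n)) →
      ∀ ε : ℝ, 0 < ε → {n ∈ S | ε ≤ Metric.diam (c '' Set.Icc (u n) (v n))}.Finite :=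
  fun _ hc _ _ _ _ hst hdisj _ hε ↦ finite_large_image hc hst hdisj hε

end Summit.CriticalPhenomena.SAWScalingLimit.Theorems.RestrictionOfLimit.Birth

end
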